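import Summits.CriticalPhenomena.PercolationContinuityZ3.Theorems.Transplant.SkeletonRankDefs
import Mathlib.Tactic.FinCases
import HarnessLib

/-!
# The free 2-step nilpotent groups `N_{m,2}` and their Cayley graphs (class map, memo `P4-GENERAL.md` §12)

builds on p205010 (kernel theorem, internal audit signed; external expert review pending) — nothing in this file uses p205010.
Lane `prim-bschramm`, seat `prim-bschramm-p4` (gen 4; class C3, abstract closing argument / class map), helper file
(`--supports stmt-CriticalPhenomena-4575`).  First file of the series `FreeNilpotent*.lean` making §11.4 of the memo
("torsion-free 2-step nilpotent groups with the FULL-RANK abelianisation skeleton leave the thick-fibre tier: Φ2 at `p_c` is free")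
a kernel theorem for the whole family of FREE 2-step nilpotent groups `N_{m,2}`, `m ≥ 3` (for `m = 2`, `N_{2,2} = H₃(ℤ)` is the
lane's tier 1b).

MAL'CEV-TYPE COORDINATES.  `N_{m,2}` is realised on `FN m = ℤ^m × ℤ^{Pr m}`, `Pr m = {(i,j) : i < j}`, with the bilinear cocycle
`β(v,v')_{(i,j)} = v_i v'_j`:
  `(v, c) · (v', c') = (v + v', c + c' + β(v, v'))`, identity `0`, `(v,c)⁻¹ = (−v, −c + β(v,v))`.
(Associativity is bilinearity of `β`; the commutator of the generators `e_i, e_j` (`i < j`) is the central unit vector `E_{(i,j)}`,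
so this is the free 2-step nilpotent group on `e_0, …, e_{m−1}`: every 2-step nilpotent group on `m` generators is a quotient, and
`rank Z = m(m−1)/2` is maximal.)  The (right) Cayley graph `fnGraph m`: `x ∼ x·e_i^{±1}`.  This file: group law (§1), generators and
the graph with its local finiteness (§2), left translations as automorphisms, transitivity, root-independence of `θ`/`p_c` (§3), the
abelianisation `x ↦ x.1` (additive, sup-norm 1-Lipschitz along edges — the skeleton map of rank `m`, §4).
[cite: KozmaNitzan2024, §4 p. 15 (the role of the symmetries of ℤ^d)] [cite: BenjaminiSchramm1996, §2 (Cayley graphs), Conj. 4]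
[cite: ContrerasMartineauTassion2024, §1.1 (nilpotent Cayley graphs, the Heisenberg example)]
-/

noncomputable section

namespace Summit.CriticalPhenomena.PercolationContinuityZ3.Theorems.Transplant

open MeasureTheory Literature.Probability.Percolation Literature.Probability.LatticeModels
open Literature.Barriers.CriticalPhenomena (IsGraphTransitive IsQuasiTransitive)

/-! ## §1 The group law in Mal'cev coordinates -/

/-- Index set of the central coordinates: ordered pairs `i < j` of generators. [folklore] -/
abbrev Pr (m : ℕ) : Type := {p : Fin m × Fin m // p.1 < p.2}

/-- The carrier of `N_{m,2}`: `(v, c)` with `v ∈ ℤ^m` (exponents of the generators) and `c ∈ ℤ^{Pr m}` (central part). [folklore] -/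
abbrev FN (m : ℕ) : Type := (Fin m → ℤ) × (Pr m → ℤ)

variable {m : ℕ}

/-- The bilinear cocycle `β(v, v')_{(i,j)} = v_i v'_j`. [folklore] -/
def fnBeta (v v' : Fin m → ℤ) : Pr m → ℤ := fun p => v p.1.1 * v' p.1.2

/-- Multiplication `(v,c)·(v',c') = (v+v', c+c'+β(v,v'))`. [folklore] -/
def fnMul (x y : FN m) : FN m := (x.1 + y.1, x.2 + y.2 + fnBeta x.1 y.1)

/-- Inversion `(v,c)⁻¹ = (−v, −c + β(v,v))`. [folklore] -/
def fnInv (x : FN m) : FN m := (-x.1, -x.2 + fnBeta x.1 x.1)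

/-- First coordinate of a product. [folklore] -/
@[simp] theorem fnMul_fst (x y : FN m) : (fnMul x y).1 = x.1 + y.1 := rfl

/-- Central coordinate of a product. [folklore] -/
@[simp] theorem fnMul_snd (x y : FN m) : (fnMul x y).2 = x.2 + y.2 + fnBeta x.1 y.1 := rfl

/-- `β` evaluated. [folklore] -/
@[simp] theorem fnBeta_apply (v v' : Fin m → ℤ) (p : Pr m) : fnBeta v v' p = v p.1.1 * v' p.1.2 := rfl

/-- `β` is additive on the left. [folklore] -/
theorem fnBeta_add_left (u v w : Fin m → ℤ) : fnBeta (u + v) w = fnBeta u w + fnBeta v w := by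
  funext p; simp [add_mul]

/-- `β` is additive on the right. [folklore] -/
theorem fnBeta_add_right (u v w : Fin m → ℤ) : fnBeta u (v + w) = fnBeta u v + fnBeta u w := by
  funext p; simp [mul_add]

/-- `β(0, v) = 0`. [folklore] -/
@[simp] theorem fnBeta_zero_left (v : Fin m → ℤ) : fnBeta 0 v = 0 := by funext p; simp
/-- `β(v, 0) = 0`. [folklore] -/
@[simp] theorem fnBeta_zero_right (v : Fin m → ℤ) : fnBeta v 0 = 0 := by funext p; simp
/-- `β(−u, v) = −β(u,v)`. [folklore] -/
@[simp] theorem fnBeta_neg_left (u v : Fin m → ℤ) : fnBeta (-u) v = -fnBeta u v := by funext p; simp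
/-- `β(u, −v) = −β(u,v)`. [folklore] -/
@[simp] theorem fnBeta_neg_right (u v : Fin m → ℤ) : fnBeta u (-v) = -fnBeta u v := by funext p; simp

/-- Associativity (bilinearity of the cocycle). [folklore] -/
theorem fnMul_assoc (x y z : FN m) : fnMul (fnMul x y) z = fnMul x (fnMul y z) := by
  refine Prod.ext ?_ ?_
  · simp [add_assoc]
  · simp only [fnMul_snd, fnMul_fst, fnBeta_add_left, fnBeta_add_right]; abel

/-- `0` is a right identity. [folklore] -/
@[simp] theorem fnMul_zero (x : FN m) : fnMul x 0 = x := by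
  refine Prod.ext ?_ ?_ <;> simp

/-- `0` is a left identity. [folklore] -/
@[simp] theorem zero_fnMul (x : FN m) : fnMul 0 x = x := by
  refine Prod.ext ?_ ?_ <;> simp

/-- Left inverse. [folklore] -/
@[simp] theorem fnInv_mul (x : FN m) : fnMul (fnInv x) x = 0 := by
  refine Prod.ext ?_ ?_
  · simp [fnInv]
  · simp only [fnMul_snd, fnInv, fnBeta_neg_left]; abel

/-- Right inverse. [folklore] -/
@[simp] theorem mul_fnInv (x : FN m) : fnMul x (fnInv x) = 0 := by
  refine Prod.ext ?_ ?_
  · simp [fnInv]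
  · simp only [fnMul_snd, fnInv, fnBeta_neg_right]; abel

/-- Left multiplication is injective. [folklore] -/
theorem fnMul_right_injective (g : FN m) : Function.Injective (fnMul g) := by
  intro a b h
  have := congrArg (fnMul (fnInv g)) h
  simpa [← fnMul_assoc] using this

/-- Right multiplication is injective. [folklore] -/
theorem fnMul_left_injective (g : FN m) : Function.Injective fun x => fnMul x g := by
  intro a b h
  have := congrArg (fun y => fnMul y (fnInv g)) h
  simpa [fnMul_assoc] using this

/-- Central elements `(0, c)` multiply by addition on the left … [folklore] -/
theorem fnMul_central_left (c : Pr m → ℤ) (x : FN m) : fnMul ((0 : Fin m → ℤ), c) x = (x.1, c + x.2) := by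
  refine Prod.ext ?_ ?_ <;> simp

/-- … and on the right. [folklore] -/
theorem fnMul_central_right (c : Pr m → ℤ) (x : FN m) : fnMul x ((0 : Fin m → ℤ), c) = (x.1, x.2 + c) := by
  refine Prod.ext ?_ ?_ <;> simp

/-! ## §2 Generators and the Cayley graph -/

/-- The generator `e_i = (δ_i, 0)`. [folklore] -/
def fnGen (i : Fin m) : FN m := (Pi.single i 1, 0)

/-- Its inverse `e_i⁻¹ = (−δ_i, 0)` (no central part: `β(δ_i, δ_i) = 0` as `i < i` is false). [folklore] -/
def fnGenInv (i : Fin m) : FN m := (-Pi.single i 1, 0)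

/-- `(e_i).1 = δ_i`. [folklore] -/
@[simp] theorem fnGen_fst (i : Fin m) : (fnGen i : FN m).1 = Pi.single i 1 := rfl
/-- `(e_i).2 = 0`. [folklore] -/
@[simp] theorem fnGen_snd (i : Fin m) : (fnGen i : FN m).2 = 0 := rfl
/-- `(e_i⁻¹).1 = −δ_i`. [folklore] -/
@[simp] theorem fnGenInv_fst (i : Fin m) : (fnGenInv i : FN m).1 = -Pi.single i 1 := rfl
/-- `(e_i⁻¹).2 = 0`. [folklore] -/
@[simp] theorem fnGenInv_snd (i : Fin m) : (fnGenInv i : FN m).2 = 0 := rfl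

/-- `β(δ_i, δ_i) = 0`. [folklore] -/
@[simp] theorem fnBeta_single_single_self (i : Fin m) (a b : ℤ) : fnBeta (Pi.single i a) (Pi.single i b) = (0 : Pr m → ℤ) := by
  funext p
  obtain ⟨⟨j, k⟩, hjk⟩ := p
  simp only [fnBeta_apply, Pi.zero_apply, Pi.single_apply]
  have hne : j ≠ k := ne_of_lt hjk
  by_cases hj : j = i
  · subst hj; simp [Ne.symm hne]
  · simp [hj]

/-- `fnInv (e_i) = e_i⁻¹`. [folklore] -/
@[simp] theorem fnInv_fnGen (i : Fin m) : fnInv (fnGen i : FN m) = fnGenInv i := by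
  refine Prod.ext ?_ ?_ <;> simp [fnInv, fnGen, fnGenInv]

/-- `e_i · e_i⁻¹ = 1`. [folklore] -/
@[simp] theorem fnGen_mul_fnGenInv (i : Fin m) : fnMul (fnGen i : FN m) (fnGenInv i) = 0 := by
  rw [← fnInv_fnGen]; exact mul_fnInv _

/-- `e_i⁻¹ · e_i = 1`. [folklore] -/
@[simp] theorem fnGenInv_mul_fnGen (i : Fin m) : fnMul (fnGenInv i : FN m) (fnGen i) = 0 := by
  rw [← fnInv_fnGen]; exact fnInv_mul _

/-- The symmetric generating set `{e_i^{±1}}`. [folklore] -/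
def fnGens (m : ℕ) : Finset (FN m) := (Finset.univ.image fnGen) ∪ (Finset.univ.image fnGenInv)

/-- Membership in the generating set. [folklore] -/
theorem mem_fnGens_iff (s : FN m) : s ∈ fnGens m ↔ ∃ i : Fin m, s = fnGen i ∨ s = fnGenInv i := by
  simp only [fnGens, Finset.mem_union, Finset.mem_image, Finset.mem_univ, true_and]
  constructor
  · rintro (⟨i, rfl⟩ | ⟨i, rfl⟩)
    · exact ⟨i, Or.inl rfl⟩
    · exact ⟨i, Or.inr rfl⟩
  · rintro ⟨i, rfl | rfl⟩
    · exact Or.inl ⟨i, rfl⟩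
    · exact Or.inr ⟨i, rfl⟩

/-- `e_i ∈ S`. [folklore] -/
theorem fnGen_mem_fnGens (i : Fin m) : (fnGen i : FN m) ∈ fnGens m := (mem_fnGens_iff _).2 ⟨i, Or.inl rfl⟩
/-- `e_i⁻¹ ∈ S`. [folklore] -/
theorem fnGenInv_mem_fnGens (i : Fin m) : (fnGenInv i : FN m) ∈ fnGens m := (mem_fnGens_iff _).2 ⟨i, Or.inr rfl⟩

/-- `S` is closed under inversion, and `s · s⁻¹ = 1` inside `S`: every `s ∈ S` has some `s' ∈ S` with `s s' = 1`. [folklore] -/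
theorem exists_fnGens_mul_eq_zero {s : FN m} (hs : s ∈ fnGens m) : ∃ s' ∈ fnGens m, fnMul s s' = 0 := by
  obtain ⟨i, rfl | rfl⟩ := (mem_fnGens_iff s).1 hs
  · exact ⟨fnGenInv i, fnGenInv_mem_fnGens i, fnGen_mul_fnGenInv i⟩
  · exact ⟨fnGen i, fnGen_mem_fnGens i, fnGenInv_mul_fnGen i⟩

/-- **The Cayley graph `Cay(N_{m,2}; e_0, …, e_{m−1})`**: `x ∼ x·e_i` (right multiplication; `fromRel` symmetrises).
[cite: BenjaminiSchramm1996, §2 (Cayley graphs)] -/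
def fnGraph (m : ℕ) : SimpleGraph (FN m) := SimpleGraph.fromRel fun x y => ∃ i : Fin m, y = fnMul x (fnGen i)

/-- Adjacency: `y = x s` for a generator `s ∈ S = {e_i^{±1}}`. [folklore] -/
theorem fnGraph_adj_iff (x y : FN m) : (fnGraph m).Adj x y ↔ ∃ s ∈ fnGens m, y = fnMul x s := by
  rw [fnGraph, SimpleGraph.fromRel_adj]
  constructor
  · rintro ⟨-, ⟨i, rfl⟩ | ⟨i, rfl⟩⟩
    · exact ⟨fnGen i, fnGen_mem_fnGens i, rfl⟩
    · exact ⟨fnGenInv i, fnGenInv_mem_fnGens i, by rw [fnMul_assoc, fnGen_mul_fnGenInv, fnMul_zero]⟩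
  · rintro ⟨s, hs, rfl⟩
    obtain ⟨i, rfl | rfl⟩ := (mem_fnGens_iff s).1 hs
    · refine ⟨fun h => ?_, Or.inl ⟨i, rfl⟩⟩
      have h1 := congrArg (fun z : FN m => z.1 i) h
      simp at h1
    · refine ⟨fun h => ?_, Or.inr ⟨i, by rw [fnMul_assoc, fnGenInv_mul_fnGen, fnMul_zero]⟩⟩
      have h1 := congrArg (fun z : FN m => z.1 i) h
      simp at h1

/-- `x ∼ x s` for every `s ∈ S`. [folklore] -/
theorem fnGraph_adj_mul_gen (x : FN m) {s : FN m} (hs : s ∈ fnGens m) : (fnGraph m).Adj x (fnMul x s) :=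
  (fnGraph_adj_iff x _).2 ⟨s, hs, rfl⟩

/-- The neighbours of `x` are the `x s`, `s ∈ S`. [folklore] -/
theorem neighborSet_fnGraph (x : FN m) : (fnGraph m).neighborSet x = ↑((fnGens m).image (fnMul x)) := by
  ext y
  rw [SimpleGraph.mem_neighborSet, fnGraph_adj_iff, Finset.coe_image, Set.mem_image]
  simp only [Finset.mem_coe, eq_comm]

/-- The Cayley graph is locally finite (degree `≤ 2m`). [folklore] -/
instance fnGraph_locallyFinite : (fnGraph m).LocallyFinite := fun x =>
  (((fnGens m).image (fnMul x)).finite_toSet.subset (neighborSet_fnGraph x).le).fintype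

/-- Along an edge the abelianisation moves by a unit vector: `y.1 = x.1 ± δ_i`. [folklore] -/
theorem fnGraph_adj_fst (x y : FN m) (h : (fnGraph m).Adj x y) : ∃ i : Fin m, y.1 = x.1 + Pi.single i 1 ∨ y.1 = x.1 - Pi.single i 1 := by
  obtain ⟨s, hs, rfl⟩ := (fnGraph_adj_iff x y).1 h
  obtain ⟨i, rfl | rfl⟩ := (mem_fnGens_iff s).1 hs
  · exact ⟨i, Or.inl (by simp)⟩
  · exact ⟨i, Or.inr (by simp [sub_eq_add_neg])⟩

/-! ## §3 Left translations, transitivity -/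

/-- Left translation `x ↦ g·x` as a permutation of the vertices. [folklore] -/
def fnLeftEquiv (g : FN m) : FN m ≃ FN m where
  toFun := fnMul g
  invFun := fnMul (fnInv g)
  left_inv x := by rw [← fnMul_assoc, fnInv_mul, zero_fnMul]
  right_inv x := by rw [← fnMul_assoc, mul_fnInv, zero_fnMul]

/-- `fnLeftEquiv g = fnMul g`. [folklore] -/
@[simp] theorem fnLeftEquiv_apply (g x : FN m) : fnLeftEquiv g x = fnMul g x := rfl

/-- **Left translations are automorphisms of the right Cayley graph.** [cite: BenjaminiSchramm1996, §2] -/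
def fnLeftIso (g : FN m) : fnGraph m ≃g fnGraph m where
  toEquiv := fnLeftEquiv g
  map_rel_iff' := by
    intro a b
    simp only [fnLeftEquiv_apply, fnGraph_adj_iff, fnMul_assoc, (fnMul_right_injective g).eq_iff]

/-- `fnLeftIso g` acts by left multiplication. [folklore] -/
@[simp] theorem fnLeftIso_apply (g x : FN m) : fnLeftIso g x = fnMul g x := rfl

/-- The Cayley graph is vertex-transitive. [cite: BenjaminiSchramm1996, §2] -/
theorem fnGraph_transitive : IsGraphTransitive (fnGraph m) := by
  intro x y
  refine ⟨fnLeftIso (fnMul y (fnInv x)), ?_⟩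
  show fnMul (fnMul y (fnInv x)) x = y
  rw [fnMul_assoc, fnInv_mul, fnMul_zero]

/-- … hence quasi-transitive with `V₀ = {1}`. [folklore] -/
theorem fnGraph_quasiTransitive : IsQuasiTransitive (fnGraph m) := by
  classical
  refine ⟨{0}, fun v => ?_⟩
  obtain ⟨γ, hγ⟩ := fnGraph_transitive v 0
  exact ⟨γ, by simp [hγ]⟩

/-- `θ` does not depend on the root. [folklore] -/
theorem theta_fnGraph_eq (v : FN m) (p : unitInterval) : theta (fnGraph m) v p = theta (fnGraph m) 0 p := by
  have h := theta_iso (fnLeftIso v) 0 p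
  have hv : fnLeftIso v 0 = v := by rw [fnLeftIso_apply, fnMul_zero]
  rw [hv] at h
  exact h

/-- `p_c` does not depend on the root. [folklore] -/
theorem criticalProb_fnGraph_eq (v : FN m) : criticalProb (fnGraph m) v = criticalProb (fnGraph m) 0 := by
  have h := criticalProb_iso (fnLeftIso v) 0
  have hv : fnLeftIso v 0 = v := by rw [fnLeftIso_apply, fnMul_zero]
  rw [hv] at h
  exact h

/-! ## §4 The abelianisation `x ↦ x.1` (the skeleton map of rank `m`) -/

/-- The abelianisation is additive. [folklore] -/
theorem fst_fnMul (x y : FN m) : (fnMul x y).1 = x.1 + y.1 := rfl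

/-- **Sup-norm 1-Lipschitz along edges**: `|x.1 j − y.1 j| ≤ 1` for adjacent `x, y`. [folklore] -/
theorem abs_fst_sub_le_one {x y : FN m} (h : (fnGraph m).Adj x y) (j : Fin m) : |x.1 j - y.1 j| ≤ 1 := by
  obtain ⟨i, hy | hy⟩ := fnGraph_adj_fst x y h
  · rw [hy, Pi.add_apply, Pi.single_apply]
    split_ifs <;> simp
  · rw [hy, Pi.sub_apply, Pi.single_apply]
    split_ifs <;> simp

/-- `β(a δ_i, b δ_j) = ab · E_{(i,j)}` for `i < j`. [folklore] -/
theorem fnBeta_single_single (i j : Fin m) (a b : ℤ) (hij : i < j) :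
    fnBeta (Pi.single i a) (Pi.single j b) = Pi.single (⟨(i, j), hij⟩ : Pr m) (a * b) := by
  funext p
  obtain ⟨⟨k, l⟩, hkl⟩ := p
  simp only [fnBeta_apply, Pi.single_apply, Subtype.mk.injEq, Prod.mk.injEq]
  by_cases hk : k = i <;> by_cases hl : l = j <;> simp [hk, hl]

/-- `β(a δ_j, b δ_i) = 0` for `i < j` (the pair `(j,i)` is not ordered). [folklore] -/
theorem fnBeta_single_single_rev (i j : Fin m) (a b : ℤ) (hij : i < j) :
    fnBeta (Pi.single j a) (Pi.single i b) = (0 : Pr m → ℤ) := by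
  funext p
  obtain ⟨⟨k, l⟩, hkl⟩ := p
  simp only [fnBeta_apply, Pi.single_apply, Pi.zero_apply]
  by_cases hk : k = j
  · subst hk
    have hl : l ≠ i := fun h => by subst h; exact lt_asymm hij hkl
    simp [hl]
  · simp [hk]

/-- The commutator of two generators: `e_i e_j e_i⁻¹ e_j⁻¹ = E_{(i,j)}` (central unit vector) for `i < j`. [folklore] -/
theorem fnGen_comm (i j : Fin m) (hij : i < j) :
    fnMul (fnMul (fnMul (fnGen i : FN m) (fnGen j)) (fnGenInv i)) (fnGenInv j) = ((0 : Fin m → ℤ), Pi.single ⟨(i, j), hij⟩ 1) := by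
  refine Prod.ext ?_ ?_
  · simp only [fnMul_fst, fnGen_fst, fnGenInv_fst]; abel
  · simp only [fnMul_snd, fnMul_fst, fnGen_snd, fnGenInv_snd, fnGen_fst, fnGenInv_fst, fnBeta_add_left, fnBeta_neg_right,
      fnBeta_neg_left, fnBeta_single_single_self, fnBeta_single_single_rev i j 1 1 hij]
    have h := fnBeta_single_single i j 1 1 hij
    rw [mul_one] at h
    rw [h]; abel

end Summit.CriticalPhenomena.PercolationContinuityZ3.Theorems.Transplant

end
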